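import Literature.Probability.RandomPlanarGeometry.HexSAWPolygonStepTwoFloorSlide
import HarnessLib

/-!
# The step `2` for honeycomb polygon numbers, SIXTH SLOT: the FLOOR CROWN at a bottom-right leaf next to a gap of the bottom row
# `#{X ∪ Y⋆ ∪ (leaf ∩ bottom-served) ∪ (floor-crown ∩ top-leaf)} ≤ q_{N+2}(ℍ)`

Topic `Literature/Probability/RandomPlanarGeometry` (lane «pcv-sawmu», a-p4 g20; the y-MIRROR IMAGE of `HexSAWPolygonStepTwoLeafCrown.lean`
at the BOTTOM corner, on top of `HexSAWPolygonStepTwoFloorSlide.lean` — `isTopLeaf_spliceAdd_low` —, `HexSAWPolygonStepTwoLeafCrown.lean`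
— `IsBotLeaf`, `botSix_of_isBotLeaf`, `not_isBotLeaf_of_bottomDatum` —, `HexSAWPolygonStepTwoTwoCorner.lean` — `BotSix`, `botAt_unique`,
`botAt_spliceAdd`, `ne_of_low`, `bottom_corner_pred/succ`, `notXb_pred_fwd`, `notXb_succ_bwd`, `BottomDatum`, `exists_stepTwoBottom_image`,
`eq_of_stepTwoBottom_image_eq`, `isTopLeaf_of_bottomDatum`, `IsStepTwoTwoCorner` —, of `HexSAWPolygonStepTwoYStar.lean` — `IsTopLeaf`,
`RoofDatum`, `exists_stepTwoRoof_image`, `eq_of_stepTwoRoof_image_eq`, `not_isTopLeaf_of_roofDatum`, `isStepTwoRoof_or_isTopLeaf` — and of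
`HexSAWPolygonStepTwoMain.lean` / `HexSAWPolygonStepSix.lean` — `spliceAdd`, `SpliceAddOK`, `spliceAddOK_of_tables`, `eq_of_spliceAdd_eq`,
`spliceAdd_site_cases`, `tpath`, `rd`).

At a bottom-right LEAF `b = [xb−2,xb]×[L,L+1]` (corner `(xb,L) = ω i₀`) whose support run is long (`ω (i₀∓5) = (xb−4, L+1)`) and whose
bottom row has a ONE-HEXAGON GAP left of `b` (`ω (i₀∓6) = (xb−4, L)`: the hexagon two places left of `b` is present), the mirror image of the
leaf crown applies: FILL the gap (`−2`) and hang the hexagon `[xb−1,xb+1]×[L−1,L]` under `b` (`+4`).  On the boundary walk: ONE window of `7`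
bonds, `(xb−4,L)(xb−4,L+1)(xb−3,L+1)(xb−2,L+1)(xb−2,L)(xb−1,L)(xb,L)(xb,L+1)`, replaced by the `9`-bond path
`(xb−4,L)(xb−3,L)(xb−2,L)(xb−1,L)(xb−1,L−1)(xb,L−1)(xb+1,L−1)(xb+1,L)(xb,L)(xb,L+1)` (tables `wVb`, `offVb`; `spliceAdd 2 7`), admissible with no
further side condition beyond `xb ≥ 6` (the hexagon two places left lies in `x ≥ 0`) and root-safe (new abscissae `≥ xb − 3 ≥ 3`).  The image's bottom corner is `(xb+1, L−1)` and its
bottom-right hexagon is again a down-right LEAF (`isBotLeaf_spliceVb`) — so the image is never a bottom image of the two-corner map —, and the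
surgery changes sites of height `≤ L + 1` in the open window only, so a TOP leaf survives (`isTopLeaf_of_floorCrownDatum`; the class records a
depth witness, a site of height `≥ L + 4`, which also keeps the site `(xm−3, H−2)` of a domino-antenna top out of the window for the sequel's
slide/crown comparison): the image is top-leaf, hence never a top image.

PART I: tables, `spliceOK_Vb`, `stepTwo_data_Vb_fwd/bwd`, `botAt_spliceVb`, signatures, `isBotLeaf_spliceVb`, `spliceVb_decode`.  PART II: the
class `IsFloorCrown`, `FloorCrownDatum`, `exists_floorCrown_image`, `eq_of_floorCrown_image_eq`, `isTopLeaf_of_floorCrownDatum`, and ★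
**`card_filter_isStepTwoFloorCrownSlot_le : 5 ≤ n → #{ω ∈ canonEnd n | IsStepTwoTwoCorner n ω ∨ (IsFloorCrown n ω ∧ IsTopLeaf n ω)} ≤
#canonEnd (n+2)`**, complement and printed forms.

NOT claimed: `q_N(ℍ) ≤ q_{N+2}(ℍ)`; the six-slot assembly.  Numerically (`HOME/pub-sawmu-a-p4/g20/three/py/slideUV2.py` with the class
conditions of this file) the floor crown serves `0, 0, 0, 0, 0, 1, 4, 10, 39` of the domino antennas for `N = 14, …, 30`; with the two corners,
the slide, the crown and the floor slide the residue of the step two becomes `1, 0, 2, 1, 6, 7, 26, 51, 172` of `12, …, 25 999` (≈ 0.66 %: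
the polygons with support runs of length one at BOTH right leaves, `149` at `N = 30`, plus `22` floor-slide sources with `xb = 5` and one
floor-crown source with three rows).  Label (lane): LANE LEMMA / infrastructure for an open combinatorial item; no literature claim beyond the
transplanted `ℤ^d` method.
-/

noncomputable section

open Finset Function Literature.Probability.LatticeModels Literature.Probability.Percolation SimpleGraph

namespace Literature.Probability.RandomPlanarGeometry.SAW

namespace HexBW

namespace PolygonConcat

variable {n : ℕ} {ω : ℕ → Site 2}

/-- Two sites of `ℤ²` are equal iff both coordinates agree. [folklore; lane plumbing] [cite: MadrasSlade1993, §1.1] -/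
private theorem fc_site_eq_iff {x y : Site 2} : x = y ↔ x 0 = y 0 ∧ x 1 = y 1 := by
  constructor
  · rintro rfl; exact ⟨rfl, rfl⟩
  · rintro ⟨h0, h1⟩; funext i; fin_cases i <;> assumption

/-- `pt a b` is lexicographically `≥ 0` when `a > 0`, or `a = 0 ≤ b`. [cite: MadrasSlade1993, §3.2 (proof of Theorem 3.2.3: `Q[N]`)] -/
private theorem fc_lexNonneg_pt {a b : ℤ} (h : 0 < a ∨ (a = 0 ∧ 0 ≤ b)) : LexNonneg (pt a b) := by
  unfold LexNonneg; simpa using h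

/-! ### PART I — the floor crown as a fixed-window surgery -/

section FloorCrownTables

variable {xb L : ℤ} {fwd : Bool} {j : ℕ}

/-- Window table of the floor crown (offsets from the bottom corner `(xb,L)`; the table `wV` with negated heights).
[cite: MadrasSlade1993, §3.2 (proof of Theorem 3.2.3: local surgery at an extreme point)] -/
def wVb : ℕ → ℤ × ℤ
  | 0 => (-4, 0) | 1 => (-4, 1) | 2 => (-3, 1) | 3 => (-2, 1) | 4 => (-2, 0) | 5 => (-1, 0) | 6 => (0, 0) | _ => (0, 1)

/-- New-path table of the floor crown (the table `offV` with negated heights). [cite: MadrasSlade1993, §3.2 (proof of Theorem 3.2.3: local surgery)] -/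
def offVb : ℕ → ℤ × ℤ
  | 0 => (-4, 0) | 1 => (-3, 0) | 2 => (-2, 0) | 3 => (-1, 0) | 4 => (-1, -1) | 5 => (0, -1) | 6 => (1, -1) | 7 => (1, 0) | 8 => (0, 0)
  | _ => (0, 1)

/-- Table V♭ is a brick-wall path (given the bottom-corner parity `xb + L` even). [cite: EntingJensen2009, §7.4.2, Fig. 7.10] -/
theorem offVb_adj (hpar : (xb + L) % 2 = 0) {s : ℕ} (hs : s < 9) :
    brickWallGraph.Adj (pt (xb + (offVb s).1) (L + (offVb s).2)) (pt (xb + (offVb (s + 1)).1) (L + (offVb (s + 1)).2)) := by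
  interval_cases s <;> simp only [offVb] <;> exact adj_pt_iff.2 (by omega)

/-- Table V♭ is injective on `[0,9]`. [cite: MadrasSlade1993, §3.2] -/
theorem offVb_inj {s s' : ℕ} (hs : s ≤ 9) (hs' : s' ≤ 9)
    (h : pt (xb + (offVb s).1) (L + (offVb s).2) = pt (xb + (offVb s').1) (L + (offVb s').2)) : s = s' := by
  interval_cases s <;> interval_cases s' <;> simp only [offVb] at h <;>
    first | rfl | (obtain ⟨h1, h2⟩ := pt_inj.1 h; omega)

/-- **The floor crown is admissible**: for `xb ≥ 6`, `(xb−3,L)` off `ω` and the window `wVb` read on `ω` from time `j`, the new path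
satisfies `SpliceAddOK n 2 7` (freshness: three new sites lie below the bottom row; `(xb+1,L)` lies right of the bottom corner; `(xb−3,L)` is off
`ω`; three are window sites). [cite: MadrasSlade1993, §3.2 (proof of Theorem 3.2.3: local surgery)] -/
theorem spliceOK_Vb (hω : ω ∈ endAt n (Pi.single 0 1 : Site 2)) (hpar : (xb + L) % 2 = 0) (hx : 6 ≤ xb)
    (hminH : ∀ i, i ≤ n → L ≤ ω i 1) (hmaxX : ∀ i, i ≤ n → ω i 1 = L → ω i 0 ≤ xb)
    (hX3 : ∀ t, t ≤ n → ω t ≠ pt (xb - 3) L)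
    (hw : ∀ s, s ≤ 7 → ω (j + s) = tpath wVb 7 xb L fwd s) (hwnd : j + 7 ≤ n) :
    SpliceAddOK n 2 7 ω j (tpath offVb 9 xb L fwd) := by
  have hinj := (mem_endAt_iff.1 hω).1.2.2.2
  have hwin : ∀ u, u ≤ 7 → ∀ i, i ≤ n → (i < j ∨ j + 7 < i) → pt (xb + (wVb u).1) (L + (wVb u).2) ≠ ω i := by
    intro u hu i hi hio he
    have hs : ∃ s, s ≤ 7 ∧ rd fwd 7 s = u := by
      cases fwd
      · exact ⟨7 - u, by omega, by unfold rd; simp; omega⟩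
      · exact ⟨u, hu, by unfold rd; simp⟩
    obtain ⟨s, hs7, hsu⟩ := hs
    have e : ω (j + s) = pt (xb + (wVb u).1) (L + (wVb u).2) := by rw [hw s hs7, tpath, hsu]
    have := hinj (show j + s ∈ {i | i ≤ n} by simp; omega) (show i ∈ {i | i ≤ n} by simpa using hi) (by rw [e, he])
    omega
  refine spliceAddOK_of_tables (L := 7) (K := 2) (w := wVb) (by norm_num) (by rfl) (by rfl) (fun s hs => offVb_adj hpar hs)
    (fun s s' hs hs' h => offVb_inj hs hs' h) (fun u hu0 hu1 i hi hio => ?_) (fun u hu => ?_) hw hwnd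
  · interval_cases u <;> simp only [offVb]
    · exact fun h => hX3 i hi (h.symm.trans (pt_inj.2 ⟨by ring, by ring⟩))
    · exact hwin 4 (by norm_num) i hi hio
    · exact hwin 5 (by norm_num) i hi hio
    · exact ne_of_low hminH hmaxX (by omega) hi
    · exact ne_of_low hminH hmaxX (by omega) hi
    · exact ne_of_low hminH hmaxX (by omega) hi
    · exact ne_of_low hminH hmaxX (by omega) hi
    · exact hwin 6 (by norm_num) i hi hio
  · interval_cases u <;> simp only [offVb] <;> exact fc_lexNonneg_pt (by omega)

end FloorCrownTables


/-! ### The forced window around a bottom-right leaf next to a gap of the bottom row -/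

section FloorCrownData

variable {xb L : ℤ}

/-- **Floor-crown datum, forward** (`ω (i₀+1) = (xb,L+1)`, `ω (i₀+2) = (xb−1,L+1)`, `ω (i₀−5) = (xb−4,L+1)`, `ω (i₀−6) = (xb−4,L)`): the
`7`-window from `i₀ − 6` is forced and the floor crown is admissible there (`xb ≥ 6`). [cite: MadrasSlade1993, §3.2 (proof of Theorem 3.2.3)] -/
theorem stepTwo_data_Vb_fwd (hω : ω ∈ canonEnd n) {i₀ : ℕ} (hi₀n : i₀ + 2 ≤ n) (hv : ω i₀ = pt xb L) (hx : 6 ≤ xb)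
    (hminH : ∀ i, i ≤ n → L ≤ ω i 1) (hmaxX : ∀ i, i ≤ n → ω i 1 = L → ω i 0 ≤ xb)
    (hX3 : ∀ t, t ≤ n → ω t ≠ pt (xb - 3) L)
    (hs1 : ω (i₀ + 1) = pt xb (L + 1)) (hs2 : ω (i₀ + 2) = pt (xb - 1) (L + 1))
    (hi₀6 : 6 ≤ i₀) (hp5 : ω (i₀ - 5) = pt (xb - 4) (L + 1)) (hp6 : ω (i₀ - 6) = pt (xb - 4) L) :
    SpliceAddOK n 2 7 ω (i₀ - 6) (tpath offVb 9 xb L true) ∧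
      (∀ s, s ≤ 7 → ω (i₀ - 6 + s) = tpath wVb 7 xb L true s) := by
  obtain ⟨hE, hlex⟩ := mem_canonEnd.1 hω
  obtain ⟨⟨h0, -, hbw, hinj⟩, hn'⟩ := mem_endAt_iff.1 hE
  have hpar : (xb + L) % 2 = 0 := by
    have hvc := vertical_cases (hbw i₀ (by omega)) (by rw [hv, hs1]; simp)
    rw [hv, hs1] at hvc; simp only [pt_apply_zero, pt_apply_one] at hvc; omega
  have p1 : ω (i₀ - 1) = pt (xb - 1) L := by
    have hadj : brickWallGraph.Adj (ω i₀) (ω (i₀ - 1)) := by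
      have := hbw (i₀ - 1) (by omega); rw [show i₀ - 1 + 1 = i₀ by omega] at this; exact this.symm
    rw [hv] at hadj
    have hne : ω (i₀ - 1) ≠ ω (i₀ + 1) := fun h => by
      have := hinj (show i₀ - 1 ∈ {i | i ≤ n} by simp; omega) (show i₀ + 1 ∈ {i | i ≤ n} by simp; omega) h; omega
    rcases adj_cases hadj with ⟨hz0, hz1⟩ | ⟨hz0, hz1⟩ | hz0
    · exfalso; have := hmaxX (i₀ - 1) (by omega) (by simp only [pt_apply_one] at hz1; omega)
      simp only [pt_apply_zero] at hz0; omega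
    · rw [fc_site_eq_iff]; simp only [pt_apply_zero, pt_apply_one] at hz0 hz1 ⊢; omega
    · rcases vertical_cases hadj hz0 with ⟨hy, hp⟩ | ⟨hy, hp⟩
      · exfalso; apply hne; rw [hs1, fc_site_eq_iff]; simp only [pt_apply_zero, pt_apply_one] at hz0 hy ⊢; omega
      · exfalso; have := hminH (i₀ - 1) (by omega); simp only [pt_apply_one] at hy; omega
  obtain ⟨hi₀2, p2⟩ := bottom_corner_pred hω (by omega) (by omega) hv (by omega) hminH p1 hs1
  obtain ⟨hi₀3, p3⟩ := notXb_pred_fwd hE hpar hminH hi₀2 (by omega) p2 p1 hX3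
  have p4 : ω (i₀ - 4) = pt (xb - 3) (L + 1) := by
    have hadj : brickWallGraph.Adj (ω (i₀ - 3)) (ω (i₀ - 4)) := by
      have := hbw (i₀ - 4) (by omega); rw [show i₀ - 4 + 1 = i₀ - 3 by omega] at this; exact this.symm
    rw [p3] at hadj
    have hne2 : ω (i₀ - 4) ≠ ω (i₀ + 2) := fun h => by
      have := hinj (show i₀ - 4 ∈ {i | i ≤ n} by simp; omega) (show i₀ + 2 ∈ {i | i ≤ n} by simp; omega) h; omega
    have hne3 : ω (i₀ - 4) ≠ ω (i₀ - 2) := fun h => by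
      have := hinj (show i₀ - 4 ∈ {i | i ≤ n} by simp; omega) (show i₀ - 2 ∈ {i | i ≤ n} by simp; omega) h; omega
    rcases adj_cases hadj with ⟨hz0, hz1⟩ | ⟨hz0, hz1⟩ | hz0
    · exfalso; apply hne2; rw [hs2, fc_site_eq_iff]; simp only [pt_apply_zero, pt_apply_one] at hz0 hz1 ⊢; omega
    · rw [fc_site_eq_iff]; simp only [pt_apply_zero, pt_apply_one] at hz0 hz1 ⊢; omega
    · rcases vertical_cases hadj hz0 with ⟨hy, hp⟩ | ⟨hy, hp⟩
      · exfalso; simp only [pt_apply_zero, pt_apply_one] at hz0 hy hp; omega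
      · exfalso; apply hne3; rw [p2, fc_site_eq_iff]; simp only [pt_apply_zero, pt_apply_one] at hz0 hy ⊢; omega
  have hw : ∀ s, s ≤ 7 → ω (i₀ - 6 + s) = tpath wVb 7 xb L true s := by
    intro s hs
    interval_cases s
    · exact tpath_eq (by rw [show i₀ - 6 + 0 = i₀ - 6 by omega, hp6]) (by simp [rd, wVb])
    · exact tpath_eq (by rw [show i₀ - 6 + 1 = i₀ - 5 by omega, hp5]) (by simp [rd, wVb])
    · exact tpath_eq (by rw [show i₀ - 6 + 2 = i₀ - 4 by omega, p4]) (by simp [rd, wVb])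
    · exact tpath_eq (by rw [show i₀ - 6 + 3 = i₀ - 3 by omega, p3]) (by simp [rd, wVb])
    · exact tpath_eq (by rw [show i₀ - 6 + 4 = i₀ - 2 by omega, p2]) (by simp [rd, wVb])
    · exact tpath_eq (by rw [show i₀ - 6 + 5 = i₀ - 1 by omega, p1]) (by simp [rd, wVb])
    · exact tpath_eq (by rw [show i₀ - 6 + 6 = i₀ by omega, hv]) (by simp [rd, wVb])
    · exact tpath_eq (by rw [show i₀ - 6 + 7 = i₀ + 1 by omega, hs1]) (by simp [rd, wVb])
  exact ⟨spliceOK_Vb hE hpar hx hminH hmaxX hX3 hw (by omega), hw⟩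

/-- **Floor-crown datum, backward** (`ω (i₀−1) = (xb,L+1)`, `ω (i₀−2) = (xb−1,L+1)`, `ω (i₀+5) = (xb−4,L+1)`, `ω (i₀+6) = (xb−4,L)`): the
`7`-window sits at `i₀ − 1` and is read backwards. [cite: MadrasSlade1993, §3.2 (proof of Theorem 3.2.3)] -/
theorem stepTwo_data_Vb_bwd (hω : ω ∈ canonEnd n) {i₀ : ℕ} (hi₀2 : 2 ≤ i₀) (hi₀6n : i₀ + 6 ≤ n) (hv : ω i₀ = pt xb L) (hx : 6 ≤ xb)
    (hminH : ∀ i, i ≤ n → L ≤ ω i 1) (hmaxX : ∀ i, i ≤ n → ω i 1 = L → ω i 0 ≤ xb)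
    (hX3 : ∀ t, t ≤ n → ω t ≠ pt (xb - 3) L)
    (hp1 : ω (i₀ - 1) = pt xb (L + 1)) (hp2 : ω (i₀ - 2) = pt (xb - 1) (L + 1))
    (hs5 : ω (i₀ + 5) = pt (xb - 4) (L + 1)) (hs6 : ω (i₀ + 6) = pt (xb - 4) L) :
    SpliceAddOK n 2 7 ω (i₀ - 1) (tpath offVb 9 xb L false) ∧
      (∀ s, s ≤ 7 → ω (i₀ - 1 + s) = tpath wVb 7 xb L false s) := by
  obtain ⟨hE, hlex⟩ := mem_canonEnd.1 hω
  obtain ⟨⟨h0, -, hbw, hinj⟩, hn'⟩ := mem_endAt_iff.1 hE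
  have hpar : (xb + L) % 2 = 0 := by
    have hvc := vertical_cases (hbw (i₀ - 1) (by omega)) (by rw [show i₀ - 1 + 1 = i₀ by omega, hv, hp1]; simp)
    rw [show i₀ - 1 + 1 = i₀ by omega, hv, hp1] at hvc; simp only [pt_apply_zero, pt_apply_one] at hvc; omega
  have s1 : ω (i₀ + 1) = pt (xb - 1) L := by
    have hadj : brickWallGraph.Adj (ω i₀) (ω (i₀ + 1)) := hbw i₀ (by omega)
    rw [hv] at hadj
    have hne : ω (i₀ + 1) ≠ ω (i₀ - 1) := fun h => by
      have := hinj (show i₀ + 1 ∈ {i | i ≤ n} by simp; omega) (show i₀ - 1 ∈ {i | i ≤ n} by simp; omega) h; omega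
    rcases adj_cases hadj with ⟨hz0, hz1⟩ | ⟨hz0, hz1⟩ | hz0
    · exfalso; have := hmaxX (i₀ + 1) (by omega) (by simp only [pt_apply_one] at hz1; omega)
      simp only [pt_apply_zero] at hz0; omega
    · rw [fc_site_eq_iff]; simp only [pt_apply_zero, pt_apply_one] at hz0 hz1 ⊢; omega
    · rcases vertical_cases hadj hz0 with ⟨hy, hp⟩ | ⟨hy, hp⟩
      · exfalso; apply hne; rw [hp1, fc_site_eq_iff]; simp only [pt_apply_zero, pt_apply_one] at hz0 hy ⊢; omega
      · exfalso; have := hminH (i₀ + 1) (by omega); simp only [pt_apply_one] at hy; omega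
  have s2 : ω (i₀ + 2) = pt (xb - 2) L := bottom_corner_succ hω (by omega) (by omega) hv hminH s1 hp1
  obtain ⟨hi₀3n, s3⟩ := notXb_succ_bwd hE hpar hminH (by omega) s2 s1 hX3
  have s4 : ω (i₀ + 4) = pt (xb - 3) (L + 1) := by
    have hadj : brickWallGraph.Adj (ω (i₀ + 3)) (ω (i₀ + 4)) := hbw (i₀ + 3) (by omega)
    rw [s3] at hadj
    have hne2 : ω (i₀ + 4) ≠ ω (i₀ - 2) := fun h => by
      have := hinj (show i₀ + 4 ∈ {i | i ≤ n} by simp; omega) (show i₀ - 2 ∈ {i | i ≤ n} by simp; omega) h; omega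
    have hne3 : ω (i₀ + 4) ≠ ω (i₀ + 2) := fun h => by
      have := hinj (show i₀ + 4 ∈ {i | i ≤ n} by simp; omega) (show i₀ + 2 ∈ {i | i ≤ n} by simp; omega) h; omega
    rcases adj_cases hadj with ⟨hz0, hz1⟩ | ⟨hz0, hz1⟩ | hz0
    · exfalso; apply hne2; rw [hp2, fc_site_eq_iff]; simp only [pt_apply_zero, pt_apply_one] at hz0 hz1 ⊢; omega
    · rw [fc_site_eq_iff]; simp only [pt_apply_zero, pt_apply_one] at hz0 hz1 ⊢; omega
    · rcases vertical_cases hadj hz0 with ⟨hy, hp⟩ | ⟨hy, hp⟩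
      · exfalso; simp only [pt_apply_zero, pt_apply_one] at hz0 hy hp; omega
      · exfalso; apply hne3; rw [s2, fc_site_eq_iff]; simp only [pt_apply_zero, pt_apply_one] at hz0 hy ⊢; omega
  have hw : ∀ s, s ≤ 7 → ω (i₀ - 1 + s) = tpath wVb 7 xb L false s := by
    intro s hs
    interval_cases s
    · exact tpath_eq (by rw [show i₀ - 1 + 0 = i₀ - 1 by omega, hp1]) (by simp [rd, wVb])
    · exact tpath_eq (by rw [show i₀ - 1 + 1 = i₀ by omega, hv]) (by simp [rd, wVb])
    · exact tpath_eq (by rw [show i₀ - 1 + 2 = i₀ + 1 by omega, s1]) (by simp [rd, wVb])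
    · exact tpath_eq (by rw [show i₀ - 1 + 3 = i₀ + 2 by omega, s2]) (by simp [rd, wVb])
    · exact tpath_eq (by rw [show i₀ - 1 + 4 = i₀ + 3 by omega, s3]) (by simp [rd, wVb])
    · exact tpath_eq (by rw [show i₀ - 1 + 5 = i₀ + 4 by omega, s4]) (by simp [rd, wVb])
    · exact tpath_eq (by rw [show i₀ - 1 + 6 = i₀ + 5 by omega, hs5]) (by simp [rd, wVb])
    · exact tpath_eq (by rw [show i₀ - 1 + 7 = i₀ + 6 by omega, hs6]) (by simp [rd, wVb])
  exact ⟨spliceOK_Vb hE hpar hx hminH hmaxX hX3 hw (by omega), hw⟩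

end FloorCrownData


/-! ### The image: bottom corner, leaf shape, decoding -/

section FloorCrownImage

variable {xb L : ℤ} {fwd : Bool} {j : ℕ}

/-- **Bottom corner of a floor-crown image**: `(xb + 1, L − 1)`, at table index `6`.
[cite: MadrasSlade1993, §3.2 (proof of Theorem 3.2.3: an extreme point)] -/
theorem botAt_spliceVb (hminH : ∀ i, i ≤ n → L ≤ ω i 1) (hmaxX : ∀ i, i ≤ n → ω i 1 = L → ω i 0 ≤ xb)
    (hP : SpliceAddOK n 2 7 ω j (tpath offVb 9 xb L fwd)) :
    BotSix (n + 2) (spliceAdd 2 7 ω (tpath offVb 9 xb L fwd) j) (L + (-1)) (xb + 1) (j + rd fwd 9 6) :=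
  botAt_spliceAdd hminH hmaxX hP (by norm_num) (by omega) (fun u hu => by
    interval_cases u <;> simp only [offVb] <;> omega) (by norm_num) rfl

/-- **Signature of a floor-crown image, forward**: corner at `j+6`, then UP to `(xb+1,L)` at `j+7`, LEFT to `(xb,L)` at `j+8`; `(xb,L−1)` at `j+5`.
[cite: MadrasSlade1993, §3.2 (proof of Theorem 3.2.3)] -/
theorem spliceVb_signature_fwd (hP : SpliceAddOK n 2 7 ω j (tpath offVb 9 xb L true)) :
    spliceAdd 2 7 ω (tpath offVb 9 xb L true) j (j + 7) = pt (xb + 1) L ∧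
    spliceAdd 2 7 ω (tpath offVb 9 xb L true) j (j + 8) = pt xb L ∧
    spliceAdd 2 7 ω (tpath offVb 9 xb L true) j (j + 5) = pt xb (L - 1) := by
  refine ⟨?_, ?_, ?_⟩
  · rw [spliceAdd_mid hP.start (by norm_num)]; simp [tpath, rd, offVb]
  · rw [spliceAdd_mid hP.start (by norm_num)]; simp [tpath, rd, offVb]
  · rw [spliceAdd_mid hP.start (by norm_num)]; simp [tpath, rd, offVb]; ring_nf

/-- **Signature of a floor-crown image, backward**: `(xb,L)` at `j+1`, `(xb+1,L)` at `j+2`, the corner at `j+3`, `(xb,L−1)` at `j+4`.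
[cite: MadrasSlade1993, §3.2 (proof of Theorem 3.2.3)] -/
theorem spliceVb_signature_bwd (hP : SpliceAddOK n 2 7 ω j (tpath offVb 9 xb L false)) :
    spliceAdd 2 7 ω (tpath offVb 9 xb L false) j (j + 2) = pt (xb + 1) L ∧
    spliceAdd 2 7 ω (tpath offVb 9 xb L false) j (j + 1) = pt xb L ∧
    spliceAdd 2 7 ω (tpath offVb 9 xb L false) j (j + 4) = pt xb (L - 1) := by
  refine ⟨?_, ?_, ?_⟩
  · rw [spliceAdd_mid hP.start (by norm_num)]; simp [tpath, rd, offVb]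
  · rw [spliceAdd_mid hP.start (by norm_num)]; simp [tpath, rd, offVb]
  · rw [spliceAdd_mid hP.start (by norm_num)]; simp [tpath, rd, offVb]; ring_nf

/-- **A floor-crown image avoids `(xb−2, L−1)`** (three steps left of its corner on the new bottom row).
[cite: MadrasSlade1993, §3.2 (proof of Theorem 3.2.3)] -/
theorem spliceVb_free_left3 (hminH : ∀ i, i ≤ n → L ≤ ω i 1) (hP : SpliceAddOK n 2 7 ω j (tpath offVb 9 xb L fwd)) :
    ∀ t, t ≤ n + 2 → spliceAdd 2 7 ω (tpath offVb 9 xb L fwd) j t ≠ pt (xb - 2) (L - 1) := by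
  intro t ht he
  rcases spliceAdd_site_cases hP ht with ⟨a, ha, -, hta⟩ | ⟨s, hs, hts⟩
  · rw [hta] at he; have := hminH a ha; rw [he] at this; simp only [pt_apply_one] at this; omega
  · rw [hts, tpath] at he
    obtain ⟨e1, e2⟩ := pt_inj.1 he
    have hr := rd_le (fwd := fwd) hs
    generalize rd fwd 9 s = u at e1 e2 hr
    interval_cases u <;> simp only [offVb] at e1 e2 <;> omega

/-- **A floor-crown image is in the bottom-leaf class** (its bottom-right hexagon, the hanging crown, has one contact).
[cite: MadrasSlade1993, §3.2 (proof of Theorem 3.2.3)] -/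
theorem isBotLeaf_spliceVb (hx2 : 2 ≤ xb)
    (hminH : ∀ i, i ≤ n → L ≤ ω i 1) (hmaxX : ∀ i, i ≤ n → ω i 1 = L → ω i 0 ≤ xb)
    (hP : SpliceAddOK n 2 7 ω j (tpath offVb 9 xb L fwd)) : IsBotLeaf (n + 2) (spliceAdd 2 7 ω (tpath offVb 9 xb L fwd) j) := by
  obtain ⟨T1, T2, T3, T4⟩ := botAt_spliceVb hminH hmaxX hP
  have hwnd := hP.wnd
  have hfree := spliceVb_free_left3 hminH hP
  refine ⟨L + (-1), xb + 1, j + rd fwd 9 6, by unfold rd; split_ifs <;> omega, T4, by omega, T1, T2,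
    fun t ht => by rw [show xb + 1 - 3 = xb - 2 by ring, show L + (-1) = L - 1 by ring]; exact hfree t ht, ?_⟩
  cases fwd
  · obtain ⟨h2, h1, -⟩ := spliceVb_signature_bwd hP
    right
    refine ⟨by unfold rd; simp, ?_, ?_⟩
    · simp only [rd, Bool.false_eq_true, ↓reduceIte, show j + (9 - 6) - 1 = j + 2 by omega, h2]; ring_nf
    · simp only [rd, Bool.false_eq_true, ↓reduceIte, show j + (9 - 6) - 2 = j + 1 by omega, h1]; ring_nf
  · obtain ⟨h7, h8, -⟩ := spliceVb_signature_fwd hP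
    left
    refine ⟨by unfold rd; simp; omega, ?_, ?_⟩
    · simp only [rd, ↓reduceIte, show j + 6 + 1 = j + 7 by omega, h7]; ring_nf
    · simp only [rd, ↓reduceIte, show j + 6 + 2 = j + 8 by omega, h8]; ring_nf

/-- **Decoding within the floor-crown class.** [cite: MadrasSlade1993, §3.2 (proof of Theorem 3.2.3: "Q can be unambiguously determined")] -/
theorem spliceVb_decode {ω₁ ω₂ : ℕ → Site 2} {xb₁ L₁ xb₂ L₂ : ℤ} {j₁ j₂ : ℕ} {fwd₁ fwd₂ : Bool}
    (hω₁ : ω₁ ∈ canonEnd n) (hω₂ : ω₂ ∈ canonEnd n)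
    (hminH₁ : ∀ i, i ≤ n → L₁ ≤ ω₁ i 1) (hmaxX₁ : ∀ i, i ≤ n → ω₁ i 1 = L₁ → ω₁ i 0 ≤ xb₁)
    (hminH₂ : ∀ i, i ≤ n → L₂ ≤ ω₂ i 1) (hmaxX₂ : ∀ i, i ≤ n → ω₂ i 1 = L₂ → ω₂ i 0 ≤ xb₂)
    (hP₁ : SpliceAddOK n 2 7 ω₁ j₁ (tpath offVb 9 xb₁ L₁ fwd₁)) (hP₂ : SpliceAddOK n 2 7 ω₂ j₂ (tpath offVb 9 xb₂ L₂ fwd₂))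
    (hw₁ : ∀ s, s ≤ 7 → ω₁ (j₁ + s) = tpath wVb 7 xb₁ L₁ fwd₁ s) (hw₂ : ∀ s, s ≤ 7 → ω₂ (j₂ + s) = tpath wVb 7 xb₂ L₂ fwd₂ s)
    (h : spliceAdd 2 7 ω₁ (tpath offVb 9 xb₁ L₁ fwd₁) j₁ = spliceAdd 2 7 ω₂ (tpath offVb 9 xb₂ L₂ fwd₂) j₂) : ω₁ = ω₂ := by
  obtain ⟨hE₁, -⟩ := mem_canonEnd.1 hω₁
  obtain ⟨hE₂, -⟩ := mem_canonEnd.1 hω₂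
  have hW : spliceAdd 2 7 ω₁ (tpath offVb 9 xb₁ L₁ fwd₁) j₁ ∈ endAt (n + 2) (Pi.single 0 1 : Site 2) := spliceAdd_mem hE₁ hP₁
  have hinj := (mem_endAt_iff.1 hW).1.2.2.2
  have T₁ := botAt_spliceVb hminH₁ hmaxX₁ hP₁
  have T₂ := botAt_spliceVb hminH₂ hmaxX₂ hP₂
  rw [← h] at T₂
  obtain ⟨eL, ex, eτ⟩ := botAt_unique hinj T₁ T₂
  have eL' : L₁ = L₂ := by omega
  have ex' : xb₁ = xb₂ := by omega
  subst eL' ex'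
  cases fwd₁ <;> cases fwd₂ <;> simp only [rd, Bool.false_eq_true, ↓reduceIte] at eτ
  · have ej : j₁ = j₂ := by omega
    subst ej
    exact eq_of_spliceAdd_eq hE₁ hE₂ hP₁ hP₂ hw₁ hw₂ h
  · exfalso
    obtain ⟨-, -, h4⟩ := spliceVb_signature_bwd hP₁
    obtain ⟨h7, -, -⟩ := spliceVb_signature_fwd hP₂
    rw [h, show j₁ + 4 = j₂ + 7 by omega, h7] at h4
    have := (pt_inj.1 h4).2; omega
  · exfalso
    obtain ⟨-, -, h4⟩ := spliceVb_signature_bwd hP₂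
    obtain ⟨h7, -, -⟩ := spliceVb_signature_fwd hP₁
    rw [← h, show j₂ + 4 = j₁ + 7 by omega, h7] at h4
    have := (pt_inj.1 h4).2; omega
  · have ej : j₁ = j₂ := by omega
    subst ej
    exact eq_of_spliceAdd_eq hE₁ hE₂ hP₁ hP₂ hw₁ hw₂ h

end FloorCrownImage


/-! ### PART II — the class, the datum, and the floor-crown-slot injection -/

section FloorCrownSlot

/-- **The floor-crown class**: a bottom corner `(xb, L) = ω i₀` of the bottom-LEAF class whose support run is long (`ω (i₀∓5) = (xb−4,L+1)`)
and whose bottom row has a one-hexagon gap left of the bottom-right hexagon (`ω (i₀∓6) = (xb−4, L)`), on a polygon with a site of height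
`≥ L + 4` (depth witness for the top-leaf transfer and for the sequel's top comparison) and `xb ≥ 6` (the hexagon two places left of the
bottom-right hexagon has abscissae `≥ 0`; recorded as a hypothesis).
[cite: MadrasSlade1993, §3.2 (proof of Theorem 3.2.3: surgery at an extreme point)] -/
def IsFloorCrown (n : ℕ) (ω : ℕ → Site 2) : Prop :=
  ∃ (L xb : ℤ) (i₀ : ℕ), i₀ + 1 ≤ n ∧ ω i₀ = pt xb L ∧ 6 ≤ xb ∧
    (∀ i, i ≤ n → L ≤ ω i 1) ∧ (∀ i, i ≤ n → ω i 1 = L → ω i 0 ≤ xb) ∧ (∀ t, t ≤ n → ω t ≠ pt (xb - 3) L) ∧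
    (∃ i, i ≤ n ∧ L + 4 ≤ ω i 1) ∧
    ((i₀ + 2 ≤ n ∧ ω (i₀ + 1) = pt xb (L + 1) ∧ ω (i₀ + 2) = pt (xb - 1) (L + 1) ∧ 6 ≤ i₀ ∧
        ω (i₀ - 5) = pt (xb - 4) (L + 1) ∧ ω (i₀ - 6) = pt (xb - 4) L) ∨
      (2 ≤ i₀ ∧ ω (i₀ - 1) = pt xb (L + 1) ∧ ω (i₀ - 2) = pt (xb - 1) (L + 1) ∧ i₀ + 6 ≤ n ∧
        ω (i₀ + 5) = pt (xb - 4) (L + 1) ∧ ω (i₀ + 6) = pt (xb - 4) L))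

/-- A polygon of the floor-crown class is in the bottom-leaf class. [cite: MadrasSlade1993, §3.2 (proof of Theorem 3.2.3)] -/
theorem isBotLeaf_of_isFloorCrown (h : IsFloorCrown n ω) : IsBotLeaf n ω := by
  obtain ⟨L, xb, i₀, hi₀n, hv, hx6, hminH, hmaxX, hX3, -, hpat⟩ := h
  rcases hpat with ⟨h2n, h1, h2, -, -, -⟩ | ⟨h2, h1, h2', -, -, -⟩
  · exact ⟨L, xb, i₀, hi₀n, hv, by omega, hminH, hmaxX, hX3, Or.inl ⟨h2n, h1, h2⟩⟩
  · exact ⟨L, xb, i₀, hi₀n, hv, by omega, hminH, hmaxX, hX3, Or.inr ⟨h2, h1, h2'⟩⟩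

/-- The decoding datum of a floor-crown image. [cite: MadrasSlade1993, §3.2 (proof of Theorem 3.2.3)] -/
def FloorCrownDatum (n : ℕ) (ω W : ℕ → Site 2) (L xb : ℤ) (j : ℕ) (fwd : Bool) : Prop :=
  2 ≤ xb ∧ SpliceAddOK n 2 7 ω j (tpath offVb 9 xb L fwd) ∧ (∀ s, s ≤ 7 → ω (j + s) = tpath wVb 7 xb L fwd s) ∧
    W = spliceAdd 2 7 ω (tpath offVb 9 xb L fwd) j

/-- **An image with its decoding datum** for every polygon of the floor-crown class (and the depth witness).
[cite: MadrasSlade1993, §3.2 (proof of Theorem 3.2.3)] -/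
theorem exists_floorCrown_image (hω : ω ∈ canonEnd n) (hm : IsFloorCrown n ω) :
    ∃ W : ℕ → Site 2, W ∈ canonEnd (n + 2) ∧ ∃ (L xb : ℤ) (j : ℕ) (fwd : Bool),
      (∀ i, i ≤ n → L ≤ ω i 1) ∧ (∀ i, i ≤ n → ω i 1 = L → ω i 0 ≤ xb) ∧ (∃ i, i ≤ n ∧ L + 4 ≤ ω i 1) ∧
        FloorCrownDatum n ω W L xb j fwd := by
  obtain ⟨L, xb, i₀, hi₀n, hv, hx6, hminH, hmaxX, hX3, hdepth, hpat⟩ := hm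
  rcases hpat with ⟨h2n, h1, h2, hi₀6, h5, h6⟩ | ⟨hi₀2, h1, h2, h6n, h5, h6⟩
  · obtain ⟨hP, hw⟩ := stepTwo_data_Vb_fwd hω h2n hv hx6 hminH hmaxX hX3 h1 h2 hi₀6 h5 h6
    exact ⟨_, spliceAdd_mem_canonEnd hω hP, L, xb, i₀ - 6, true, hminH, hmaxX, hdepth, by omega, hP, hw, rfl⟩
  · obtain ⟨hP, hw⟩ := stepTwo_data_Vb_bwd hω hi₀2 h6n hv hx6 hminH hmaxX hX3 h1 h2 h5 h6
    exact ⟨_, spliceAdd_mem_canonEnd hω hP, L, xb, i₀ - 1, false, hminH, hmaxX, hdepth, by omega, hP, hw, rfl⟩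

/-- **Decoding of floor-crown images is datum-free.** [cite: MadrasSlade1993, §3.2 (proof of Theorem 3.2.3: "Q can be unambiguously determined")] -/
theorem eq_of_floorCrown_image_eq {ω₁ ω₂ W : ℕ → Site 2} (hω₁ : ω₁ ∈ canonEnd n) (hω₂ : ω₂ ∈ canonEnd n)
    {L₁ xb₁ : ℤ} {j₁ : ℕ} {fwd₁ : Bool} {L₂ xb₂ : ℤ} {j₂ : ℕ} {fwd₂ : Bool}
    (hminH₁ : ∀ i, i ≤ n → L₁ ≤ ω₁ i 1) (hmaxX₁ : ∀ i, i ≤ n → ω₁ i 1 = L₁ → ω₁ i 0 ≤ xb₁)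
    (hminH₂ : ∀ i, i ≤ n → L₂ ≤ ω₂ i 1) (hmaxX₂ : ∀ i, i ≤ n → ω₂ i 1 = L₂ → ω₂ i 0 ≤ xb₂)
    (h₁ : FloorCrownDatum n ω₁ W L₁ xb₁ j₁ fwd₁) (h₂ : FloorCrownDatum n ω₂ W L₂ xb₂ j₂ fwd₂) : ω₁ = ω₂ := by
  obtain ⟨-, hP₁, hw₁, rfl⟩ := h₁
  obtain ⟨-, hP₂, hw₂, h⟩ := h₂
  exact spliceVb_decode hω₁ hω₂ hminH₁ hmaxX₁ hminH₂ hmaxX₂ hP₁ hP₂ hw₁ hw₂ h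

/-- **A floor-crown image of a top-leaf polygon is a top leaf**: the interior window sites and new sites have height `≤ L + 1 ≤ H − 3`.
[cite: MadrasSlade1993, §3.2 (proof of Theorem 3.2.3)] -/
theorem isTopLeaf_of_floorCrownDatum {W : ℕ → Site 2} {L xb : ℤ} {j : ℕ} {fwd : Bool}
    (hd : FloorCrownDatum n ω W L xb j fwd) (hdepth : ∃ i, i ≤ n ∧ L + 4 ≤ ω i 1) (hleaf : IsTopLeaf n ω) :
    IsTopLeaf (n + 2) W := by
  obtain ⟨-, hP, hw, rfl⟩ := hd
  obtain ⟨t, ht, hth⟩ := hdepth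
  refine isTopLeaf_spliceAdd_low (B := L + 1) hP (by norm_num) (fun s hs0 hs1 => ?_) (fun s hs0 hs1 => ?_) hleaf (fun H hH => ?_)
  · rw [tpath, pt_apply_one]
    have hr : 0 < rd fwd 9 s ∧ rd fwd 9 s < 9 := by unfold rd; split_ifs <;> omega
    generalize rd fwd 9 s = u at hr
    obtain ⟨hr0, hr1⟩ := hr
    interval_cases u <;> simp [offVb]
  · rw [hw s (by omega), tpath, pt_apply_one]
    have hr : 0 < rd fwd 7 s ∧ rd fwd 7 s < 7 := by unfold rd; split_ifs <;> omega
    generalize rd fwd 7 s = u at hr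
    obtain ⟨hr0, hr1⟩ := hr
    interval_cases u <;> simp [wVb]
  · have := hH t ht; omega

/-- **The class served by the floor-crown slot on top of the two corners**: the two-corner class, or floor-crown ∧ top-leaf.
[cite: MadrasSlade1993, §3.2 (proof of Theorem 3.2.3)] -/
def IsStepTwoFloorCrownSlot (n : ℕ) (ω : ℕ → Site 2) : Prop := IsStepTwoTwoCorner n ω ∨ (IsFloorCrown n ω ∧ IsTopLeaf n ω)

/-- **★ The step two holds on the floor-crown-slot class**: the canonical rooted `(n+1)`-gons (`n ≥ 5`) of class
X ∪ Y⋆ ∪ (leaf ∩ bottom-served) ∪ (floor-crown ∩ top-leaf) inject into the canonical rooted `(n+3)`-gons.  Images pairwise distinct: top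
images are not top-leaf; bottom images are top-leaf and not bottom-leaf; floor-crown images are top-leaf and bottom-leaf.
[cite: MadrasSlade1993, §3.2, Theorem 3.2.3 / (3.2.3) (the `ℤ^d` statement being transplanted)] -/
theorem card_filter_isStepTwoFloorCrownSlot_le [DecidablePred (IsStepTwoFloorCrownSlot n)] (hn : 5 ≤ n) :
    #((canonEnd n).filter (IsStepTwoFloorCrownSlot n)) ≤ #(canonEnd (n + 2)) := by
  classical
  let P1 : (ℕ → Site 2) → Prop := fun ω => ω ∈ canonEnd n ∧ IsStepTwoRoof n ω
  let P2 : (ℕ → Site 2) → Prop := fun ω => ω ∈ canonEnd n ∧ IsTopLeaf n ω ∧ IsStepTwoBottom n ω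
  let P3 : (ℕ → Site 2) → Prop := fun ω => ω ∈ canonEnd n ∧ IsFloorCrown n ω ∧ IsTopLeaf n ω
  let E : (ℕ → Site 2) → (ℕ → Site 2) := fun ω =>
    if h : P1 ω then Classical.choose (exists_stepTwoRoof_image h.1 hn h.2)
    else if h' : P2 ω then Classical.choose (exists_stepTwoBottom_image h'.1 hn h'.2.2)
    else if h'' : P3 ω then Classical.choose (exists_floorCrown_image h''.1 h''.2.1)
    else ω
  have hE1 : ∀ ω (h : P1 ω), E ω = Classical.choose (exists_stepTwoRoof_image h.1 hn h.2) := fun ω h => dif_pos h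
  have hE2 : ∀ ω, ¬ P1 ω → ∀ h' : P2 ω, E ω = Classical.choose (exists_stepTwoBottom_image h'.1 hn h'.2.2) := by
    intro ω h1 h'
    show (if h : P1 ω then _ else _) = _
    rw [dif_neg h1, dif_pos h']
  have hE3 : ∀ ω, ¬ P1 ω → ¬ P2 ω → ∀ h'' : P3 ω, E ω = Classical.choose (exists_floorCrown_image h''.1 h''.2.1) := by
    intro ω h1 h2 h''
    show (if h : P1 ω then _ else _) = _
    rw [dif_neg h1, dif_neg h2, dif_pos h'']
  have himgR : ∀ ω (h : P1 ω), E ω ∈ canonEnd (n + 2) ∧ ¬ IsTopLeaf (n + 2) (E ω) ∧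
      ∃ (H xm : ℤ) (j k : ℕ) (fwd : Bool), (∀ i, i ≤ n → ω i 1 ≤ H) ∧ (∀ i, i ≤ n → ω i 1 = H → ω i 0 ≤ xm) ∧
        RoofDatum n ω (E ω) H xm j k fwd := by
    intro ω h
    rw [hE1 ω h]
    obtain ⟨hW, H, xm, j, k, fwd, hmaxH, hmaxX, hd⟩ := Classical.choose_spec (exists_stepTwoRoof_image h.1 hn h.2)
    exact ⟨hW, not_isTopLeaf_of_roofDatum h.1 (by omega) hmaxH hmaxX hd, H, xm, j, k, fwd, hmaxH, hmaxX, hd⟩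
  have himgB : ∀ ω, ¬ P1 ω → ∀ h' : P2 ω, E ω ∈ canonEnd (n + 2) ∧ IsTopLeaf (n + 2) (E ω) ∧ ¬ IsBotLeaf (n + 2) (E ω) ∧
      ∃ (L xb : ℤ) (j k : ℕ) (fwd : Bool), (∀ i, i ≤ n → L ≤ ω i 1) ∧ (∀ i, i ≤ n → ω i 1 = L → ω i 0 ≤ xb) ∧
        BottomDatum n ω (E ω) L xb j k fwd := by
    intro ω h1 h'
    rw [hE2 ω h1 h']
    obtain ⟨hW, L, xb, j, k, fwd, hminH, hmaxX, hd⟩ :=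
      Classical.choose_spec (exists_stepTwoBottom_image h'.1 hn h'.2.2)
    exact ⟨hW, isTopLeaf_of_bottomDatum h'.1 hd h'.2.1, not_isBotLeaf_of_bottomDatum h'.1 hminH hmaxX hd,
      L, xb, j, k, fwd, hminH, hmaxX, hd⟩
  have himgC : ∀ ω, ¬ P1 ω → ¬ P2 ω → ∀ h'' : P3 ω, E ω ∈ canonEnd (n + 2) ∧ IsTopLeaf (n + 2) (E ω) ∧ IsBotLeaf (n + 2) (E ω) ∧
      ∃ (L xb : ℤ) (j : ℕ) (fwd : Bool), (∀ i, i ≤ n → L ≤ ω i 1) ∧ (∀ i, i ≤ n → ω i 1 = L → ω i 0 ≤ xb) ∧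
        FloorCrownDatum n ω (E ω) L xb j fwd := by
    intro ω h1 h2 h''
    rw [hE3 ω h1 h2 h'']
    obtain ⟨hW, L, xb, j, fwd, hminH, hmaxX, hdepth, hd⟩ := Classical.choose_spec (exists_floorCrown_image h''.1 h''.2.1)
    refine ⟨hW, isTopLeaf_of_floorCrownDatum hd hdepth h''.2.2, ?_, L, xb, j, fwd, hminH, hmaxX, hd⟩
    obtain ⟨hx2, hP, -, hWeq⟩ := hd
    rw [hWeq]; exact isBotLeaf_spliceVb hx2 hminH hmaxX hP
  have hbranch : ∀ ω, ω ∈ canonEnd n → IsStepTwoFloorCrownSlot n ω → P1 ω ∨ (¬ P1 ω ∧ P2 ω) ∨ (¬ P1 ω ∧ ¬ P2 ω ∧ P3 ω) := by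
    intro ω hω hc
    by_cases h1 : P1 ω
    · exact Or.inl h1
    by_cases h2 : P2 ω
    · exact Or.inr (Or.inl ⟨h1, h2⟩)
    refine Or.inr (Or.inr ⟨h1, h2, hω, ?_⟩)
    rcases hc with (hR | ⟨hl, hb⟩) | hs
    · exact absurd ⟨hω, hR⟩ h1
    · exact absurd ⟨hω, hl, hb⟩ h2
    · exact hs
  refine Finset.card_le_card_of_injOn E (fun ω hω => ?_) (fun ω₁ hω₁ ω₂ hω₂ heq => ?_)
  · rw [Finset.mem_coe, Finset.mem_filter] at hω
    rw [Finset.mem_coe]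
    rcases hbranch ω hω.1 hω.2 with h1 | ⟨h1, h2⟩ | ⟨h1, h2, h3⟩
    · exact (himgR ω h1).1
    · exact (himgB ω h1 h2).1
    · exact (himgC ω h1 h2 h3).1
  · rw [Finset.mem_coe, Finset.mem_filter] at hω₁ hω₂
    rcases hbranch ω₁ hω₁.1 hω₁.2 with a1 | ⟨a1, a2⟩ | ⟨a1, a2, a3⟩ <;>
      rcases hbranch ω₂ hω₂.1 hω₂.2 with b1 | ⟨b1, b2⟩ | ⟨b1, b2, b3⟩
    · obtain ⟨-, -, H₁, xm₁, j₁, k₁, fwd₁, hmaxH₁, hmaxX₁, h₁⟩ := himgR ω₁ a1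
      obtain ⟨-, -, H₂, xm₂, j₂, k₂, fwd₂, hmaxH₂, hmaxX₂, h₂⟩ := himgR ω₂ b1
      rw [heq] at h₁
      exact eq_of_stepTwoRoof_image_eq hω₁.1 hω₂.1 hmaxH₁ hmaxX₁ hmaxH₂ hmaxX₂ h₁ h₂
    · exfalso
      obtain ⟨-, hnl, -⟩ := himgR ω₁ a1
      obtain ⟨-, hl, -⟩ := himgB ω₂ b1 b2
      rw [heq] at hnl; exact hnl hl
    · exfalso
      obtain ⟨-, hnl, -⟩ := himgR ω₁ a1
      obtain ⟨-, hl, -⟩ := himgC ω₂ b1 b2 b3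
      rw [heq] at hnl; exact hnl hl
    · exfalso
      obtain ⟨-, hnl, -⟩ := himgR ω₂ b1
      obtain ⟨-, hl, -⟩ := himgB ω₁ a1 a2
      rw [← heq] at hnl; exact hnl hl
    · obtain ⟨-, -, -, L₁, xb₁, j₁, k₁, fwd₁, hminH₁, hmaxX₁, h₁⟩ := himgB ω₁ a1 a2
      obtain ⟨-, -, -, L₂, xb₂, j₂, k₂, fwd₂, hminH₂, hmaxX₂, h₂⟩ := himgB ω₂ b1 b2
      rw [heq] at h₁
      exact eq_of_stepTwoBottom_image_eq hω₁.1 hω₂.1 hminH₁ hmaxX₁ hminH₂ hmaxX₂ h₁ h₂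
    · exfalso
      obtain ⟨-, -, hnb, -⟩ := himgB ω₁ a1 a2
      obtain ⟨-, -, hbl, -⟩ := himgC ω₂ b1 b2 b3
      rw [heq] at hnb; exact hnb hbl
    · exfalso
      obtain ⟨-, hnl, -⟩ := himgR ω₂ b1
      obtain ⟨-, hl, -⟩ := himgC ω₁ a1 a2 a3
      rw [← heq] at hnl; exact hnl hl
    · exfalso
      obtain ⟨-, -, hbl, -⟩ := himgC ω₁ a1 a2 a3
      obtain ⟨-, -, hnb, -⟩ := himgB ω₂ b1 b2
      rw [heq] at hbl; exact hnb hbl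
    · obtain ⟨-, -, -, L₁, xb₁, j₁, fwd₁, hminH₁, hmaxX₁, h₁⟩ := himgC ω₁ a1 a2 a3
      obtain ⟨-, -, -, L₂, xb₂, j₂, fwd₂, hminH₂, hmaxX₂, h₂⟩ := himgC ω₂ b1 b2 b3
      rw [heq] at h₁
      exact eq_of_floorCrown_image_eq hω₁.1 hω₂.1 hminH₁ hmaxX₁ hminH₂ hmaxX₂ h₁ h₂

/-- **Complement form**: `#canonEnd n − #{leaf polygons served neither at the bottom nor by the floor crown} ≤ #canonEnd (n+2)`.
[cite: MadrasSlade1993, §3.2, Theorem 3.2.3 / (3.2.3)] -/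
theorem card_canonEnd_sub_card_filter_floorCrownSlotResidue_le [DecidablePred (IsStepTwoFloorCrownSlot n)]
    [DecidablePred fun ω => IsTopLeaf n ω ∧ ¬ IsStepTwoBottom n ω ∧ ¬ IsFloorCrown n ω] (hn : 5 ≤ n) :
    #(canonEnd n) - #((canonEnd n).filter fun ω => IsTopLeaf n ω ∧ ¬ IsStepTwoBottom n ω ∧ ¬ IsFloorCrown n ω) ≤
      #(canonEnd (n + 2)) := by
  classical
  have hcover : canonEnd n ⊆ (canonEnd n).filter (IsStepTwoFloorCrownSlot n) ∪
      (canonEnd n).filter (fun ω => IsTopLeaf n ω ∧ ¬ IsStepTwoBottom n ω ∧ ¬ IsFloorCrown n ω) := by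
    intro ω hω
    rcases isStepTwoRoof_or_isTopLeaf hω hn with h | h
    · exact Finset.mem_union_left _ (Finset.mem_filter.2 ⟨hω, Or.inl (Or.inl h)⟩)
    · by_cases hb : IsStepTwoBottom n ω
      · exact Finset.mem_union_left _ (Finset.mem_filter.2 ⟨hω, Or.inl (Or.inr ⟨h, hb⟩)⟩)
      · by_cases hs : IsFloorCrown n ω
        · exact Finset.mem_union_left _ (Finset.mem_filter.2 ⟨hω, Or.inr ⟨hs, h⟩⟩)
        · exact Finset.mem_union_right _ (Finset.mem_filter.2 ⟨hω, h, hb, hs⟩)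
  have h1 := (Finset.card_le_card hcover).trans (Finset.card_union_le _ _)
  have h2 := card_filter_isStepTwoFloorCrownSlot_le (n := n) hn
  omega

/-- **Printed normalisation**: `q_{n+1}(ℍ) − #{floor-crown-slot residue} ≤ q_{n+3}(ℍ)` (`n ≥ 5`). [cite: MadrasSlade1993, §3.2, Theorem 3.2.3 / (3.2.3)] -/
theorem hexPolygonNumber_sub_card_floorCrownSlotResidue_le
    [DecidablePred fun ω => IsTopLeaf n ω ∧ ¬ IsStepTwoBottom n ω ∧ ¬ IsFloorCrown n ω] (hn : 5 ≤ n) :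
    hexPolygonNumber (n + 1) - #((canonEnd n).filter fun ω => IsTopLeaf n ω ∧ ¬ IsStepTwoBottom n ω ∧ ¬ IsFloorCrown n ω) ≤
      hexPolygonNumber (n + 3) := by
  classical
  have h := card_canonEnd_sub_card_filter_floorCrownSlotResidue_le (n := n) hn
  rw [card_canonEnd (by omega), card_canonEnd (by omega)] at h
  exact h

end FloorCrownSlot

end PolygonConcat

end HexBW

end Literature.Probability.RandomPlanarGeometry.SAW

end
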